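import Mathlib
import HarnessLib
import Summits.HubbardSuperconductivity.HubbardSuperconductivity.Theorems.KLProgrammeH10TwoPointLimitPerturbedFermiRadiusAccel

/-!
# Route `KLProgramme` — crux K1 `H10TwoPointLimit` (stmt-HubbardSuperconductivity-19938):
# STRICT CONVEXITY of the perturbed Fermi curve (the `h_min` field on the moving curve) and the fold quantity `sin X·X'' + sin Y·Y''`

The fold analysis of the sector count (`odd_transversal`, `even_key` in `HubbardBandSectorCountingToolbox`) rests on two facts about the FREE
band curve at ONE level: strict convexity `h_min ≤ cos X·X'² + cos Y·Y'²` (`BandBounds.hess_ge`) and the identity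
`sin X·X'' + sin Y·Y'' = -(cos X·X'² + cos Y·Y'²)` (`sin_mul_acc_eq_neg_hess`). On the perturbed curve `{ε₀ + δ = μ}` (root selection `u`,
`δ ∈ C²` with `|δ| ≤ κ₀`, `‖Dδ‖ ≤ κ₁ < Dt_min`, `‖D(Dδ)‖ ≤ κ₂` on the closed square, `[μ - κ₀, μ + κ₀] ⊂ [a, b]`), architecture (β) of
HOME/prover-p4/PORT-NOTE.md gives both up to `O(κ₁ + κ₂)`:

* `hess_perturbed_ge` — **`cos X_E·X_E'² + cos Y_E·Y_E'² ≥ h_min - 4 κ₁ C_V (S_E + s_max)`**: the perturbed point IS the free point of the shifted level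
  (`XE_eq_bandX_shifted`), the free `hess_ge` holds there, and the velocities differ by `≤ κ₁ C_V` (`abs_VXE_sub_bandVX_le`);
* `sin_mul_accel_eq` — `sin X_E·X_E'' + sin Y_E·Y_E'' = -(cos X_E·X_E'² + cos Y_E·Y_E'²) - ½(D²δ(p)[v,v] + Dδ(p)[v'])` (half of
  `levelIdentity_two`), with `X_E'' = u'' cos θ - 2u' sin θ - u cos θ`, `Y_E'' = u'' sin θ + 2u' cos θ - u sin θ`;
* `abs_sin_mul_accel_ge` — hence **`|sin X_E·X_E'' + sin Y_E·Y_E''| ≥ h_min - 4κ₁C_V(S_E + s_max) - ½(κ₂ S_E² + κ₁ (U₂ + 2U₁ + π√2))`**,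
  the transversality constant of `odd_transversal` on the moving curve (`C_V`, `S_E`, `U₁`, `U₂` as in `…Accel.lean`).

Everything is PROVED; no definitions. References: BGM 2006 §2.4 Lemma 2.1 (2.40)–(2.41), App. A2 [cite: BenfattoGiulianiMastropietro2006].
-/

noncomputable section

namespace Summit.HubbardSuperconductivity.HubbardSuperconductivity.Theorems.PerturbedFermiCurve

set_option linter.dupNamespace false -- summit = problem name (single-conjunct summit), D-0017

open Real Set
open Literature.MathematicalPhysics.QuantumLattice Literature.MathematicalPhysics.QuantumLattice.BandSectorCounting

section Convexity

variable {a b : ℝ} (B : BandBounds a b) {δ : (Fin 2 → ℝ) → ℝ} (hδs : ContDiff ℝ 2 δ)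
  {κ₀ κ₁ κ₂ μ : ℝ} (hδ : ∀ k : Fin 2 → ℝ, (∀ i, |k i| ≤ π) → |δ k| ≤ κ₀) (hlo : a ≤ μ - κ₀) (hhi : μ + κ₀ ≤ b)
  (hκ : ∀ k : Fin 2 → ℝ, (∀ i, |k i| ≤ π) → ‖fderiv ℝ δ k‖ ≤ κ₁) (hκ₁ : κ₁ < B.Dtmin)
  (hκ₂ : ∀ k : Fin 2 → ℝ, (∀ i, |k i| ≤ π) → ‖fderiv ℝ (fderiv ℝ δ) k‖ ≤ κ₂)
  {u : ℝ → ℝ} (hu : ∀ θ, IsBandFermiRadius (μ - δ (u θ • dir θ)) θ (u θ))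
include B hδs hδ hlo hhi hκ hκ₁ hu

/-- **Strict convexity of the perturbed curve**: `cos X_E X_E'² + cos Y_E Y_E'² ≥ h_min - 4 κ₁ C_V (S_E + s_max)` (the `hess_ge` field of the
moving curve, from the free one at the shifted level plus the `O(κ₁)` velocity error). [cite: BenfattoGiulianiMastropietro2006, §2.4 Lemma 2.1] -/
theorem hess_perturbed_ge (θ : ℝ) :
    B.hmin - 4 * (κ₁ * (π * Real.sqrt 2 + 2 * B.smax) / (B.Dtmin - κ₁)) *
        ((B.smax + κ₁ * (π * Real.sqrt 2 + 2 * B.smax) / (B.Dtmin - κ₁)) + B.smax) ≤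
      Real.cos (XE u θ) * VXE u θ ^ 2 + Real.cos (YE u θ) * VYE u θ ^ 2 := by
  have h2ne : (2 : WithTop ℕ∞) ≠ 0 := by norm_num
  set KV := κ₁ * (π * Real.sqrt 2 + 2 * B.smax) / (B.Dtmin - κ₁) with hKV
  set SE := B.smax + κ₁ * (π * Real.sqrt 2 + 2 * B.smax) / (B.Dtmin - κ₁) with hSE
  set ν := μ - δ (u θ • dir θ) with hν
  have hνmem : ν ∈ Icc a b := shiftedLevel_mem_Icc (hu θ) hδ hlo hhi
  obtain ⟨hXeq, hYeq⟩ := XE_eq_bandX_shifted B hδ hlo hhi hu θ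
  obtain ⟨hvx, hvy⟩ := abs_VXE_le B hδs h2ne hδ hlo hhi hκ hκ₁ hu θ
  obtain ⟨hdvx, hdvy⟩ := abs_VXE_sub_bandVX_le B hδs h2ne hδ hlo hhi hκ hκ₁ hu θ
  have hsmx := B.abs_VX_le ν hνmem θ
  have hsmy := B.abs_VY_le ν hνmem θ
  have hfree := B.hess_ge ν hνmem θ
  rw [← hXeq, ← hYeq] at hfree
  have hcX := Real.abs_cos_le_one (XE u θ); have hcY := Real.abs_cos_le_one (YE u θ)
  have hKV0 : 0 ≤ KV := (abs_nonneg _).trans hdvx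
  -- the two square differences
  have t1 : |Real.cos (XE u θ) * (VXE u θ ^ 2 - bandVX ν θ ^ 2)| ≤ KV * (SE + B.smax) := by
    have hf : VXE u θ ^ 2 - bandVX ν θ ^ 2 = (VXE u θ - bandVX ν θ) * (VXE u θ + bandVX ν θ) := by ring
    rw [hf, abs_mul, abs_mul]
    have hsum : |VXE u θ + bandVX ν θ| ≤ SE + B.smax := (abs_add_le _ _).trans (add_le_add hvx hsmx)
    have e : |VXE u θ - bandVX ν θ| * |VXE u θ + bandVX ν θ| ≤ KV * (SE + B.smax) :=
      mul_le_mul hdvx hsum (abs_nonneg _) hKV0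
    have e2 : |Real.cos (XE u θ)| * (|VXE u θ - bandVX ν θ| * |VXE u θ + bandVX ν θ|) ≤ 1 * (KV * (SE + B.smax)) :=
      mul_le_mul hcX e (by positivity) zero_le_one
    linarith
  have t2 : |Real.cos (YE u θ) * (VYE u θ ^ 2 - bandVY ν θ ^ 2)| ≤ KV * (SE + B.smax) := by
    have hf : VYE u θ ^ 2 - bandVY ν θ ^ 2 = (VYE u θ - bandVY ν θ) * (VYE u θ + bandVY ν θ) := by ring
    rw [hf, abs_mul, abs_mul]
    have hsum : |VYE u θ + bandVY ν θ| ≤ SE + B.smax := (abs_add_le _ _).trans (add_le_add hvy hsmy)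
    have e : |VYE u θ - bandVY ν θ| * |VYE u θ + bandVY ν θ| ≤ KV * (SE + B.smax) :=
      mul_le_mul hdvy hsum (abs_nonneg _) hKV0
    have e2 : |Real.cos (YE u θ)| * (|VYE u θ - bandVY ν θ| * |VYE u θ + bandVY ν θ|) ≤ 1 * (KV * (SE + B.smax)) :=
      mul_le_mul hcY e (by positivity) zero_le_one
    linarith
  have hid : Real.cos (XE u θ) * VXE u θ ^ 2 + Real.cos (YE u θ) * VYE u θ ^ 2 =
      (Real.cos (XE u θ) * bandVX ν θ ^ 2 + Real.cos (YE u θ) * bandVY ν θ ^ 2) +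
        (Real.cos (XE u θ) * (VXE u θ ^ 2 - bandVX ν θ ^ 2) + Real.cos (YE u θ) * (VYE u θ ^ 2 - bandVY ν θ ^ 2)) := by ring
  rw [hid]
  have a1 := neg_abs_le (Real.cos (XE u θ) * (VXE u θ ^ 2 - bandVX ν θ ^ 2))
  have a2 := neg_abs_le (Real.cos (YE u θ) * (VYE u θ ^ 2 - bandVY ν θ ^ 2))
  have hSE0 : 0 ≤ SE := (abs_nonneg _).trans hvx
  have hprod : 0 ≤ KV * (SE + B.smax) := mul_nonneg hKV0 (by linarith [B.smax_pos])
  linarith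

/-- **The fold quantity on the perturbed curve**: `sin X_E·X_E'' + sin Y_E·Y_E'' = -(cos X_E X_E'² + cos Y_E Y_E'²) - ½(D²δ(p)[v,v] + Dδ(p)[v'])`
(half of `levelIdentity_two`; the tree's `sin_mul_acc_eq_neg_hess` on the moving curve). [cite: BenfattoGiulianiMastropietro2006, §2.4 Lemma 2.1 (2.41)] -/
theorem sin_mul_accel_eq (θ : ℝ) :
    Real.sin (XE u θ) * (deriv (deriv u) θ * Real.cos θ - 2 * deriv u θ * Real.sin θ - u θ * Real.cos θ) +
        Real.sin (YE u θ) * (deriv (deriv u) θ * Real.sin θ + 2 * deriv u θ * Real.cos θ - u θ * Real.sin θ) =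
      -(Real.cos (XE u θ) * VXE u θ ^ 2 + Real.cos (YE u θ) * VYE u θ ^ 2) -
        (fderiv ℝ (fderiv ℝ δ) (u θ • dir θ) ![VXE u θ, VYE u θ] ![VXE u θ, VYE u θ] +
          fderiv ℝ δ (u θ • dir θ)
            ![deriv (deriv u) θ * Real.cos θ - 2 * deriv u θ * Real.sin θ - u θ * Real.cos θ,
              deriv (deriv u) θ * Real.sin θ + 2 * deriv u θ * Real.cos θ - u θ * Real.sin θ]) / 2 := by
  have h2ne : (2 : WithTop ℕ∞) ≠ 0 := by norm_num
  have hroot : ∀ ϑ, sqDispersion (u ϑ • dir ϑ) + δ (u ϑ • dir ϑ) = μ := fun ϑ =>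
    ((isBandFermiRadius_shifted_iff δ μ ϑ (u ϑ)).1 (hu ϑ)).2
  have hu2 : ContDiff ℝ 2 u := contDiff_of_isRoot B hδs h2ne hδ hlo hhi hκ hκ₁ hu
  have h := levelIdentity_two hδs hu2 hroot θ
  linarith

include hκ₂

/-- **Transversality constant of the fold on the moving curve**:
`|sin X_E·X_E'' + sin Y_E·Y_E''| ≥ h_min - 4κ₁C_V(S_E + s_max) - ½(κ₂ S_E² + κ₁ (U₂ + 2U₁ + π√2))` — the `h_min` of `odd_transversal` /
`even_key` for the perturbed curve, explicit in `(κ₁, κ₂)` and the `BandBounds` fields. [cite: BenfattoGiulianiMastropietro2006, App. A2] -/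
theorem abs_sin_mul_accel_ge (θ : ℝ) :
    B.hmin - 4 * (κ₁ * (π * Real.sqrt 2 + 2 * B.smax) / (B.Dtmin - κ₁)) *
          ((B.smax + κ₁ * (π * Real.sqrt 2 + 2 * B.smax) / (B.Dtmin - κ₁)) + B.smax) -
        (κ₂ * (B.smax + κ₁ * (π * Real.sqrt 2 + 2 * B.smax) / (B.Dtmin - κ₁)) ^ 2 +
          κ₁ * (((4 + κ₂) * (B.smax + κ₁ * (π * Real.sqrt 2 + 2 * B.smax) / (B.Dtmin - κ₁)) ^ 2 +
              (8 + 2 * κ₁) * ((4 + κ₁) * (π * Real.sqrt 2) / (B.Dtmin - κ₁)) + (4 + κ₁) * (π * Real.sqrt 2)) / (B.Dtmin - κ₁) +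
            2 * ((4 + κ₁) * (π * Real.sqrt 2) / (B.Dtmin - κ₁)) + π * Real.sqrt 2)) / 2 ≤
      |Real.sin (XE u θ) * (deriv (deriv u) θ * Real.cos θ - 2 * deriv u θ * Real.sin θ - u θ * Real.cos θ) +
        Real.sin (YE u θ) * (deriv (deriv u) θ * Real.sin θ + 2 * deriv u θ * Real.cos θ - u θ * Real.sin θ)| := by
  have h2ne : (2 : WithTop ℕ∞) ≠ 0 := by norm_num
  set SE := B.smax + κ₁ * (π * Real.sqrt 2 + 2 * B.smax) / (B.Dtmin - κ₁) with hSE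
  set U1 := (4 + κ₁) * (π * Real.sqrt 2) / (B.Dtmin - κ₁) with hU1
  set U2 := ((4 + κ₂) * SE ^ 2 + (8 + 2 * κ₁) * U1 + (4 + κ₁) * (π * Real.sqrt 2)) / (B.Dtmin - κ₁) with hU2
  have hsq := abs_apply_le_pi_of_isBandFermiRadius (hu θ)
  have hden : 0 < B.Dtmin - κ₁ := sub_pos.2 hκ₁
  obtain ⟨hvx, hvy⟩ := abs_VXE_le B hδs h2ne hδ hlo hhi hκ hκ₁ hu θ
  have hupos : 0 < u θ := (mem_Ioo_of_shifted B hδ hlo hhi (hu θ)).1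
  have hule : u θ ≤ π * Real.sqrt 2 := root_le_pi_mul_sqrt_two B hδ hlo hhi hu θ
  have hκ₁0 : 0 ≤ κ₁ := le_trans (norm_nonneg _) (hκ _ hsq)
  have hκ₂0 : 0 ≤ κ₂ := (norm_nonneg (fderiv ℝ (fderiv ℝ δ) (u θ • dir θ))).trans (hκ₂ _ hsq)
  have hSE0 : 0 ≤ SE := (abs_nonneg _).trans hvx
  have hu1 : |deriv u θ| ≤ U1 := by
    refine (abs_deriv_le B hδs h2ne hδ hlo hhi hκ hκ₁ hu θ).trans ?_
    rw [hU1]; exact div_le_div_of_nonneg_right (mul_le_mul_of_nonneg_left hule (by linarith)) hden.le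
  have hU10 : 0 ≤ U1 := (abs_nonneg _).trans hu1
  have hu2b : |deriv (deriv u) θ| ≤ U2 := abs_second_deriv_le B hδs hδ hlo hhi hκ hκ₁ hκ₂ hu θ
  -- the two `δ` terms
  have hv : ‖(![VXE u θ, VYE u θ] : Fin 2 → ℝ)‖ ≤ SE := norm_vec2_le hSE0 hvx hvy
  have hD2 : |fderiv ℝ (fderiv ℝ δ) (u θ • dir θ) ![VXE u θ, VYE u θ] ![VXE u θ, VYE u θ]| ≤ κ₂ * SE ^ 2 := by
    refine (abs_fderiv_fderiv_le (hκ₂ _ hsq) ![VXE u θ, VYE u θ] ![VXE u θ, VYE u θ]).trans ?_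
    rw [sq, mul_assoc]
    exact mul_le_mul_of_nonneg_left (mul_le_mul hv hv (norm_nonneg _) hSE0) hκ₂0
  have hsθ := Real.abs_sin_le_one θ; have hcθ := Real.abs_cos_le_one θ
  have hacc0 : |deriv (deriv u) θ * Real.cos θ - 2 * deriv u θ * Real.sin θ - u θ * Real.cos θ| ≤ U2 + 2 * U1 + π * Real.sqrt 2 := by
    have e1 : |deriv (deriv u) θ * Real.cos θ| ≤ U2 := by
      rw [abs_mul]; exact (mul_le_of_le_one_right (abs_nonneg _) hcθ).trans hu2b
    have e2 : |2 * deriv u θ * Real.sin θ| ≤ 2 * U1 := by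
      rw [abs_mul, abs_mul, abs_two]
      have := mul_le_of_le_one_right (abs_nonneg (deriv u θ)) hsθ
      nlinarith [abs_nonneg (deriv u θ)]
    have e3 : |u θ * Real.cos θ| ≤ π * Real.sqrt 2 := by
      rw [abs_mul, abs_of_pos hupos]; exact (mul_le_of_le_one_right hupos.le hcθ).trans hule
    have := abs_sub (deriv (deriv u) θ * Real.cos θ - 2 * deriv u θ * Real.sin θ) (u θ * Real.cos θ)
    have := abs_sub (deriv (deriv u) θ * Real.cos θ) (2 * deriv u θ * Real.sin θ)
    linarith
  have hacc1 : |deriv (deriv u) θ * Real.sin θ + 2 * deriv u θ * Real.cos θ - u θ * Real.sin θ| ≤ U2 + 2 * U1 + π * Real.sqrt 2 := by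
    have e1 : |deriv (deriv u) θ * Real.sin θ| ≤ U2 := by
      rw [abs_mul]; exact (mul_le_of_le_one_right (abs_nonneg _) hsθ).trans hu2b
    have e2 : |2 * deriv u θ * Real.cos θ| ≤ 2 * U1 := by
      rw [abs_mul, abs_mul, abs_two]
      have := mul_le_of_le_one_right (abs_nonneg (deriv u θ)) hcθ
      nlinarith [abs_nonneg (deriv u θ)]
    have e3 : |u θ * Real.sin θ| ≤ π * Real.sqrt 2 := by
      rw [abs_mul, abs_of_pos hupos]; exact (mul_le_of_le_one_right hupos.le hsθ).trans hule
    have := abs_sub (deriv (deriv u) θ * Real.sin θ + 2 * deriv u θ * Real.cos θ) (u θ * Real.sin θ)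
    have := abs_add_le (deriv (deriv u) θ * Real.sin θ) (2 * deriv u θ * Real.cos θ)
    linarith
  have hA0 : 0 ≤ U2 + 2 * U1 + π * Real.sqrt 2 := (abs_nonneg _).trans hacc0
  have hD1 : |fderiv ℝ δ (u θ • dir θ)
      ![deriv (deriv u) θ * Real.cos θ - 2 * deriv u θ * Real.sin θ - u θ * Real.cos θ,
        deriv (deriv u) θ * Real.sin θ + 2 * deriv u θ * Real.cos θ - u θ * Real.sin θ]| ≤ κ₁ * (U2 + 2 * U1 + π * Real.sqrt 2) :=
    abs_fderiv_vec2_le (hκ _ hsq) hA0 hacc0 hacc1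
  -- assemble
  have hhess := hess_perturbed_ge B hδs hδ hlo hhi hκ hκ₁ hu θ
  rw [sin_mul_accel_eq B hδs hδ hlo hhi hκ hκ₁ hu θ]
  have key : ∀ (H D : ℝ), B.hmin - 4 * (κ₁ * (π * Real.sqrt 2 + 2 * B.smax) / (B.Dtmin - κ₁)) * (SE + B.smax) ≤ H →
      |D| ≤ κ₂ * SE ^ 2 + κ₁ * (U2 + 2 * U1 + π * Real.sqrt 2) →
      B.hmin - 4 * (κ₁ * (π * Real.sqrt 2 + 2 * B.smax) / (B.Dtmin - κ₁)) * (SE + B.smax) -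
        (κ₂ * SE ^ 2 + κ₁ * (U2 + 2 * U1 + π * Real.sqrt 2)) / 2 ≤ |-H - D / 2| := by
    intro H D hH hDb
    have e : -H - D / 2 = -(H + D / 2) := by ring
    rw [e, abs_neg]
    have := le_abs_self (H + D / 2)
    have := (abs_le.1 hDb).1
    linarith
  exact key _ _ hhess ((abs_add_le _ _).trans (add_le_add hD2 hD1))

end Convexity

end Summit.HubbardSuperconductivity.HubbardSuperconductivity.Theorems.PerturbedFermiCurve

end
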